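import Summits.ABC.IUTFork.Thm311RealInd1StripTwistJWFirstPlanes
import Literature.AnabelianGeometry.AbsoluteAnabelian.MLFGaloisDiekertTwists
import HarnessLib

/-!
# [IUTchIII] Thm 3.11 (i) (Ind1) at a DYADIC place `v ∣ 2` with `√−1 ∈ K_v`: Nishio's unipotent shear `y_d ↦ y_d + y_{d−1}` of `K_v`
# REALISED in print's (Ind1) strip part from the group-level fact `DiekertNishioTwists`; hence the strip part is INFINITE at every
# dyadic place of a field containing `√−1` (the `p = 2` twin of `Thm311RealInd1StripTwistJW` / `…TwistJWFirst` / `…Infinite`)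

PROOF-ONLY file (abc-iut cell, Cor. 3.12 sub-crew, seat abc-iut-c312-1 = holder of record of the typed [IUTchIII] Thm. 3.11, gen 23; row
R33 «C:P2-DIEKERT-TWIST» (plan g18 C-R197 (a) GO by ruling), file (υ2), CONDITIONAL on the named fact of file (υ1)
`Literature/AnabelianGeometry/AbsoluteAnabelian/MLFGaloisDiekertTwists.lean`).  TAKES NO SIDE on [IUTchIII] Cor. 3.12.  No definition, no
`Prop` fact; the ONE hypothesis is `DiekertNishioTwists` (Diekert 1984 Thm. 3.1 as restated in Nishio arXiv:2512.05095 Prop. 2.1, with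
the twist of Def. 2.5), displayed as a binder.

WHY (row R32): `2 ∈ T(I)` for every Θ-volume input, the tame-odd R-rows are empty at `2`, and the (Ind1) strip part AS TYPED had NO
engine at `2` (`JannsenWingbergTwists` carries `p ≠ 2`); for GENUINE initial Θ-data `√−1 ∈ F ⊆ K` ([IUTchI] Def. 3.1 (a);
`InitialThetaDataArith.sqrt_neg_one_mem`), so EVERY dyadic place of `K` is in Nishio's case `a(G) ≥ 2` — the case of the fact.
* §0 `lastIndex_injective`, `exists_lastIndex_eq` — the indexing `Fin g ⊕ Fin 2 → {1, …, g+2}` (`y_1..y_{d−2}`, then `y_{d−1}, y_d`).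
* §1 **`Real.dehnTwistLast_closureAt_of_diekertNishio`** — at a finite place `v` with `p_v = 2`, `√−1 ∈ K_v`, `d = [K_v : ℚ_2] ≥ 2`:
  a `ℚ_2`-basis `y` of `K_v` indexed by `Fin (d−2) ⊕ Fin 2` and a topological automorphism `φ` of `G_v` acting through THE equivariant
  lift on unit logarithms as the transvection `y_d ↦ y_d + y_{d−1}` (Nishio Thm. 2.6's `α_+`); gen 11/12's proof verbatim up to the
  indexing (Nishio Lemma 2.3 PROVED; `θ(liftUnits φ u) = φ^{ab}(θ u)` turns `α(x_d) = x_d x_{d−1}` into the transvection; kit BY NAME).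
* §2 **`Real.exists_realised_shear_of_diekertNishio`** — the same as a member `ψ₀ ∈ Real.ind1StripOf v (Real.galoisLog v)` on the
  rescaled completion; §3 **`Real.ind1StripOf_infinite_of_diekertNishio`** — hence print's (Ind1) strip part AS TYPED is INFINITE at
  every such place (`n ↦ n • ψ₀` injective; Nishio Thm. 2.6 / Cor. 2.7 (i) in kernel form), also over the analytic logarithm;
  Dupuy–Hilado's strip slot is `{1}`.
HONEST SCOPE: conditional theorems (binder `hDN`) about OUR typed objects at ONE dyadic place; STRUCTURE only — NOTHING about hulls,
rooms, bits or the `p = 2` summand identity of R32 (no R-row at `2` exists), which way that residual goes is NOT claimed; Nishio Thm. 3.5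
(absolutely abelian `k`) is NOT used; nothing here asserts or refutes [IUTchIII] Cor. 3.12; no side taken; NO abc claim. [claim: Mochizuki2012,
status: disputed]; [cite: Mochizuki2012, IUTchIII Thm. 3.11 (i) (Ind1) p. 154]; [cite: Nishio2025OuterAutDyadic, Prop. 2.1 (= Diekert1984
Thm. 3.1), Def. 2.5, Lem. 2.3–2.4, Thm. 2.6, Cor. 2.7 (i)]; [cite: Diekert1984, Thm. 3.1 (J. reine angew. Math. 350, pp. 152–172)];
[cite: DupuyHilado2025, §4.7]. typed ≠ proved; a conditional theorem discharges nothing it binds.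
-/

set_option autoImplicit false
noncomputable section
open Metric Set
open scoped Pointwise

namespace Summit.ABC.IUTFork.Thm311.Real

open NumberField IsDedekindDomain Literature.NumberTheory.NumberFields Literature.IUT.LogVolume
open Literature.NumberTheory.GaloisRepresentations
open Literature.AnabelianGeometry.AbsoluteAnabelian Literature.IUT.HodgeArakelov
open Literature.IUT.HodgeArakelov.AbsTopMonoids

variable {F : Type} [Field F] [NumberField F] (v : HeightOneSpectrum (𝓞 F))

/-- The indexing `inl t ↦ t + 1`, `inr ε ↦ g + 1 + ε` is injective. [folklore] -/
theorem lastIndex_injective (g : ℕ) :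
    Function.Injective (fun s' : Fin g ⊕ Fin 2 =>
      Sum.elim (fun t : Fin g => (t : ℕ) + 1) (fun ε : Fin 2 => g + 1 + (ε : ℕ)) s') := by
  rintro (t | ε) (t' | ε') h <;> simp only [Sum.elim_inl, Sum.elim_inr] at h
  · exact congrArg Sum.inl (Fin.ext (by omega))
  · have := t.2; omega
  · have := t'.2; omega
  · exact congrArg Sum.inr (Fin.ext (by omega))

/-- Every `j ∈ {1, …, g + 2}` is an index. [folklore] -/
theorem exists_lastIndex_eq (g : ℕ) {j : ℕ} (hj1 : 1 ≤ j) (hj2 : j ≤ g + 2) :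
    ∃ s' : Fin g ⊕ Fin 2, Sum.elim (fun t : Fin g => (t : ℕ) + 1) (fun ε : Fin 2 => g + 1 + (ε : ℕ)) s' = j := by
  by_cases h : j ≤ g
  · exact ⟨Sum.inl ⟨j - 1, by omega⟩, by simp only [Sum.elim_inl]; omega⟩
  · exact ⟨Sum.inr ⟨j - g - 1, by omega⟩, by simp only [Sum.elim_inr]; omega⟩

/-- **NISHIO'S SHEAR `y_d ↦ y_d + y_{d−1}` AT `closureAt v`, FROM THE GROUP-LEVEL FACT `DiekertNishioTwists`.**  At a finite place `v` of a
number field `F` with residue characteristic `p_v = 2`, `√−1 ∈ K_v` and `d = [K_v : ℚ_2] ≥ 2`, there are `g` (`g + 2 = d`) and a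
`ℚ_2`-basis `y` of `K_v` indexed by `Fin g ⊕ Fin 2` (`y_{inl t} = log θ⁻¹[x_{t+1}]`, `y_{inr 0} = log θ⁻¹[x_{d−1}]`, `y_{inr 1} = log θ⁻¹[x_d]`;
Nishio Lemma 2.3, PROVED here as in gen 11) such that the transvection `t ↦ t + y^*_{inr 1}(t)·y_{inr 0}` (`y_d ↦ y_d + y_{d−1}`, every
other basis vector fixed — Nishio Thm. 2.6 «`y_{d(G)} = α^n_+(y_{d(G)}) = y_{d(G)} + n y_{d(G)−1}`» at `n = 1`) is realised by a topological
automorphism of `G_v` through THE equivariant lift on unit logarithms (`MLFClosure.LiftActsOnUnitLogAs`). [claim: Mochizuki2012, status: disputed]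
[cite: Nishio2025OuterAutDyadic, Prop. 2.1 (= Diekert1984 Thm. 3.1), Def. 2.5, Lem. 2.3–2.4, Thm. 2.6] [cite: Diekert1984, Thm. 3.1 (J. reine angew. Math. 350, pp. 152–172)] -/
theorem dehnTwistLast_closureAt_of_diekertNishio (hDN : DiekertNishioTwists)
    [Fact (closureAt v).residueChar.Prime]
    (hpk : ValuativeRel.valuation (v.adicCompletion F) (closureAt v).residueChar < 1) (hp2 : (closureAt v).residueChar = 2)
    (hi : ∃ i : (closureAt v).k, i ^ 2 = -1)
    (hfin : haveI : CharZero (closureAt v).k := (closureAt v).instChar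
      letI : Algebra ℚ_[(closureAt v).residueChar] (closureAt v).k :=
        LocalField.padicAlgebra (closureAt v).k (closureAt v).residueChar hpk
      2 ≤ Module.finrank ℚ_[(closureAt v).residueChar] (closureAt v).k) :
    haveI : CharZero (closureAt v).k := (closureAt v).instChar
    letI : Algebra ℚ_[(closureAt v).residueChar] (closureAt v).k :=
      LocalField.padicAlgebra (closureAt v).k (closureAt v).residueChar hpk
    ∃ (g : ℕ) (_ : g + 2 = Module.finrank ℚ_[(closureAt v).residueChar] (closureAt v).k)
      (y : Module.Basis (Fin g ⊕ Fin 2) ℚ_[(closureAt v).residueChar] (closureAt v).k),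
      ∃ φ : (ModelMLFGaloisData.galois (closureAt v).k (closureAt v).K).tmPair.Pi ≃ₜ*
          (ModelMLFGaloisData.galois (closureAt v).k (closureAt v).K).tmPair.Pi,
        (closureAt v).LiftActsOnUnitLogAs (closureAt v).residueChar hpk φ fun t =>
          t + y.coord (Sum.inr 1) t • y (Sum.inr 0) := by
  -- notation and structures
  have hv : (((closureAt v).residueChar : ℕ) : 𝓞 F) ∈ v.asIdeal := natCast_residueChar_closureAt_mem v
  haveI : CharZero (v.adicCompletion F) := charZero_adicCompletion v
  letI iQ : Algebra ℚ_[(closureAt v).residueChar] (v.adicCompletion F) :=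
    LocalField.padicAlgebra (v.adicCompletion F) (closureAt v).residueChar hpk
  haveI : ValuativeExtension (v.adicCompletion F) (v.adicCompletion F) := ⟨fun _ _ => Iff.rfl⟩
  haveI : ContinuousSMul ℚ_[(closureAt v).residueChar] (v.adicCompletion F) :=
    continuousSMul_of_algebraMap ℚ_[(closureAt v).residueChar] _
      (by exact LocalField.continuous_algebraMap_adicCompletionPadicAlgebra v (closureAt v).residueChar hv)
  haveI : FiniteDimensional ℚ_[(closureAt v).residueChar] (RescaledCompletion F (closureAt v).residueChar v hv) :=
    FiniteDimensional.of_locallyCompactSpace ℚ_[(closureAt v).residueChar]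
  set d := Module.finrank ℚ_[(closureAt v).residueChar] (v.adicCompletion F) with hd
  have hd2 : 2 ≤ d := hfin
  -- the Diekert–Nishio data at `K_v`, with the twist on the last pair `(x_{d−1}, x_d)`
  obtain ⟨σ, τ, x, u, s, H, -, -, hwild, hdense, hs, hH, htor, hlast⟩ :=
    hDN (v.adicCompletion F) (closureAt v).residueChar hpk hp2 hi (by omega)
  -- the principal units `u_j` as units of `𝒪_v`
  have hunit : ∀ j, j ≤ d → ∃ w : (↥(v.adicCompletionIntegers F))ˣ, unitsToK v w = u j := by
    intro j hj
    apply exists_unit_coe_eq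
    rw [Valuation.mem_unitGroup_iff]
    have h := Valuation.map_one_add_of_lt (ValuativeRel.valuation (v.adicCompletion F)) (hwild j hj).1
    rwa [add_sub_cancel] at h
  choose! uO huO using hunit
  set S : Set (↥(v.adicCompletionIntegers F))ˣ := uO '' Set.Iic d with hSdef
  have hSmap : (Subgroup.closure S).map (unitsToK v) = Subgroup.closure (u '' Set.Iic d) := by
    rw [MonoidHom.map_closure]
    congr 1
    ext z
    constructor
    · rintro ⟨w, ⟨j, hj, rfl⟩, rfl⟩; exact ⟨j, hj, (huO j hj).symm⟩
    · rintro ⟨j, hj, rfl⟩; exact ⟨uO j, ⟨j, hj, rfl⟩, huO j hj⟩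
  have hS : ∀ w : (↥(v.adicCompletionIntegers F))ˣ,
      ValuativeRel.valuation (v.adicCompletion F) (((w : ↥(v.adicCompletionIntegers F)) : v.adicCompletion F) - 1) < 1 →
        unitsToK v w ∈ (((Subgroup.closure S).map (unitsToK v)).topologicalClosure : Subgroup (v.adicCompletion F)ˣ) := by
    intro w hw
    rw [hSmap]
    exact hdense (unitsToK v w) hw
  -- the logarithms `y_j`, read in the rescaled completion
  set e := RescaledCompletion.of F (closureAt v).residueChar v hv with he
  let eL : v.adicCompletion F ≃ₗ[ℚ_[(closureAt v).residueChar]] RescaledCompletion F (closureAt v).residueChar v hv :=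
    { e.toAddEquiv with
      map_smul' := fun c x => by
        change e (c • x) = c • e x
        rw [Algebra.smul_def, Algebra.smul_def, map_mul]
        rfl }
  have heL : ∀ z, eL z = e z := fun z => rfl
  let yR : ℕ → RescaledCompletion F (closureAt v).residueChar v hv := fun j => e (galoisLog v (Additive.ofMul (uO j)))
  -- (Hoshi–Nishio Lemma 1.3, spanning) every element is in the span of `y_0, …, y_d`
  have hspan : ∀ z, z ∈ Submodule.span ℚ_[(closureAt v).residueChar] (yR '' Set.Iic d) := by
    intro z
    have h := mem_span_of_galoisLog_of_generators v (closureAt v).residueChar hv S hS z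
    rwa [hSdef, Set.image_image] at h
  -- the abelianised relation: `H • y_0 + p^s • y_1 = 0`
  have htor' : IsOfFinOrder (uO 0 ^ H * uO 1 ^ ((closureAt v).residueChar ^ s)) := by
    have hmap : unitsToK v (uO 0 ^ H * uO 1 ^ ((closureAt v).residueChar ^ s)) =
        u 0 ^ H * u 1 ^ ((closureAt v).residueChar ^ s) := by
      rw [map_mul, map_zpow, map_pow, huO 0 (by omega), huO 1 (by omega)]
    obtain ⟨n, hn, hpow⟩ := htor.exists_pow_eq_one
    exact isOfFinOrder_iff_pow_eq_one.mpr ⟨n, hn, unitsToK_injective v (by rw [map_pow, hmap, hpow, map_one])⟩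
  have hrel : (H : ℚ_[(closureAt v).residueChar]) • yR 0 +
      (((closureAt v).residueChar ^ s : ℕ) : ℚ_[(closureAt v).residueChar]) • yR 1 = 0 := by
    obtain ⟨n, hn, hpow⟩ := htor'.exists_pow_eq_one
    have h0 : galoisLog v (Additive.ofMul (uO 0 ^ H * uO 1 ^ ((closureAt v).residueChar ^ s))) = 0 := by
      have h1 : (n : v.adicCompletion F) *
          galoisLog v (Additive.ofMul (uO 0 ^ H * uO 1 ^ ((closureAt v).residueChar ^ s))) = 0 := by
        rw [← nsmul_eq_mul, ← map_nsmul, ← ofMul_pow, hpow, ofMul_one, map_zero]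
      exact (mul_eq_zero.mp h1).resolve_left (by exact_mod_cast hn.ne')
    rw [ofMul_mul, ofMul_zpow, ofMul_pow, map_add, map_zsmul, map_nsmul] at h0
    have h1 := congrArg e h0
    rw [map_add, map_zsmul, map_nsmul, map_zero, ← Int.cast_smul_eq_zsmul ℚ_[(closureAt v).residueChar],
      ← Nat.cast_smul_eq_nsmul ℚ_[(closureAt v).residueChar]] at h1
    exact h1
  have hy0 : yR 0 ∈ Submodule.span ℚ_[(closureAt v).residueChar] {yR 1} := by
    have hH0 : (H : ℚ_[(closureAt v).residueChar]) ≠ 0 := by exact_mod_cast hH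
    have h1 : (H : ℚ_[(closureAt v).residueChar]) • yR 0 =
        -((((closureAt v).residueChar ^ s : ℕ) : ℚ_[(closureAt v).residueChar]) • yR 1) :=
      eq_neg_of_add_eq_zero_left hrel
    have h : yR 0 = (H : ℚ_[(closureAt v).residueChar])⁻¹ •
        (-((((closureAt v).residueChar ^ s : ℕ) : ℚ_[(closureAt v).residueChar]) • yR 1)) := by
      rw [← h1, smul_smul, inv_mul_cancel₀ hH0, one_smul]
    rw [h, ← smul_neg, smul_smul]
    exact Submodule.smul_mem _ _ (Submodule.neg_mem _ (Submodule.mem_span_singleton_self _))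
  -- hence `y_1, …, y_d` span
  have hspan1 : ∀ z, z ∈ Submodule.span ℚ_[(closureAt v).residueChar] (yR '' Set.Icc 1 d) := by
    intro z
    have hsub : yR '' Set.Iic d ⊆ (Submodule.span ℚ_[(closureAt v).residueChar] (yR '' Set.Icc 1 d) :
        Set (RescaledCompletion F (closureAt v).residueChar v hv)) := by
      rintro _ ⟨j, hj, rfl⟩
      rcases Nat.eq_zero_or_pos j with rfl | hjpos
      · refine Submodule.span_mono ?_ hy0
        rintro _ rfl
        exact ⟨1, ⟨le_rfl, by omega⟩, rfl⟩
      · exact Submodule.subset_span ⟨j, ⟨hjpos, hj⟩, rfl⟩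
    exact Submodule.span_le.mpr hsub (hspan z)
  -- the indexing `y_1, …, y_{d−2}` (`inl`), `y_{d−1}, y_d` (`inr 0`, `inr 1`)
  let g : ℕ := d - 2
  have hcg : g + 2 = d := by simp only [g]; omega
  let idx : Fin g ⊕ Fin 2 → ℕ := fun s' =>
    Sum.elim (fun t : Fin g => (t : ℕ) + 1) (fun ε : Fin 2 => g + 1 + (ε : ℕ)) s'
  have hidx_inj : Function.Injective idx := lastIndex_injective g
  have hidx_mem : ∀ s', 1 ≤ idx s' ∧ idx s' ≤ d := by
    rintro (t | ε)
    · have := t.2; simp only [idx, Sum.elim_inl]; omega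
    · have := ε.2; simp only [idx, Sum.elim_inr]; omega
  -- the basis of `K_v^{(1/n_v)}`, then of `K_v`
  let bfam : Fin g ⊕ Fin 2 → RescaledCompletion F (closureAt v).residueChar v hv := fun s' => yR (idx s')
  have hle : ⊤ ≤ Submodule.span ℚ_[(closureAt v).residueChar] (Set.range bfam) := by
    intro z _
    have hsub : yR '' Set.Icc 1 d ⊆ Set.range bfam := by
      rintro _ ⟨j, ⟨hj1, hj2⟩, rfl⟩
      obtain ⟨s', hs'⟩ := exists_lastIndex_eq g hj1 (by omega)
      exact ⟨s', by simp only [bfam, idx]; rw [hs']⟩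
    exact Submodule.span_mono hsub (hspan1 z)
  have hcard : Fintype.card (Fin g ⊕ Fin 2) =
      Module.finrank ℚ_[(closureAt v).residueChar] (RescaledCompletion F (closureAt v).residueChar v hv) := by
    rw [← eL.finrank_eq]
    simp only [Fintype.card_sum, Fintype.card_fin]
    omega
  let bR : Module.Basis (Fin g ⊕ Fin 2) ℚ_[(closureAt v).residueChar]
      (RescaledCompletion F (closureAt v).residueChar v hv) := basisOfTopLeSpanOfCardEqFinrank bfam hle hcard
  have hbR : ∀ s', bR s' = yR (idx s') := fun s' => by
    change (basisOfTopLeSpanOfCardEqFinrank bfam hle hcard : _ → _) s' = _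
    rw [coe_basisOfTopLeSpanOfCardEqFinrank]
  let y : Module.Basis (Fin g ⊕ Fin 2) ℚ_[(closureAt v).residueChar] (v.adicCompletion F) := bR.map eL.symm
  have hy : ∀ s', y s' = galoisLog v (Additive.ofMul (uO (idx s'))) := fun s' => by
    change eL.symm (bR s') = _
    rw [hbR]
    exact e.symm_apply_apply _
  have hycoord : ∀ s' t, y.coord s' t = bR.coord s' (e t) := by
    intro s' t
    change (bR.map eL.symm).repr t s' = bR.repr (eL t) s'
    rw [Module.Basis.map_repr, LinearEquiv.trans_apply, LinearEquiv.symm_symm]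
  -- coordinates of the `y_j`, `j ≤ d`, at any index other than that of `y_1`
  have hcoord : ∀ (s₀ : Fin g ⊕ Fin 2) (j : ℕ), j ≤ d → idx s₀ ≠ 1 →
      bR.coord s₀ (yR j) = if j = idx s₀ then 1 else 0 := by
    intro s₀ j hj hs₀
    rcases Nat.eq_zero_or_pos j with rfl | hjpos
    · -- `y_0 = λ • y_1 = λ • bR (inl 0)`
      obtain ⟨s₁, hs₁⟩ := exists_lastIndex_eq g (le_refl 1) (by omega : 1 ≤ g + 2)
      have hs₁' : idx s₁ = 1 := hs₁
      have hne01 : s₁ ≠ s₀ := fun h => hs₀ (h ▸ hs₁')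
      obtain ⟨q, hq⟩ := Submodule.mem_span_singleton.mp hy0
      have hne : (0 : ℕ) ≠ idx s₀ := by have := (hidx_mem s₀).1; omega
      rw [if_neg hne, ← hq, ← hs₁', ← hbR, map_smul, Module.Basis.coord_apply, Module.Basis.repr_self,
        Finsupp.single_apply, if_neg hne01, smul_zero]
    · obtain ⟨s₁, hs₁⟩ := exists_lastIndex_eq g hjpos (by omega)
      have hs₁' : idx s₁ = j := hs₁
      rw [← hs₁', ← hbR, Module.Basis.coord_apply, Module.Basis.repr_self, Finsupp.single_apply]
      by_cases h : s₁ = s₀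
      · subst h; rw [if_pos rfl, if_pos rfl]
      · rw [if_neg h, if_neg (fun h' => h (hidx_inj h'))]
  -- `[x_j] = θ (u_j)` on the units of `𝒪_v`
  have hθ : ∀ j, j ≤ d → absGaloisAbProj (v.adicCompletion F) (x j) =
      (LocalWeilDatum.isReciprocitySystemE (F := v.adicCompletion F) (E := v.adicCompletion F)
        (LocalWeilDatum.isClassFieldTheory_localWeilDatum (v.adicCompletion F))).theta (unitsToK v (uO j)) := by
    intro j hj; rw [huO j hj]; exact (hwild j hj).2
  -- ONE TWIST `x_b ↦ x_b x_a` ⟹ the transvection `y_b ↦ y_b + y_a` (Kondo's computation), for any two basis positions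
  have htwist : ∀ (sa sb : Fin g ⊕ Fin 2), idx sb ≠ 1 → JWTwist σ τ x d (idx sa) (idx sb) →
      ∃ φ : (ModelMLFGaloisData.galois (closureAt v).k (closureAt v).K).tmPair.Pi ≃ₜ*
          (ModelMLFGaloisData.galois (closureAt v).k (closureAt v).K).tmPair.Pi,
        (closureAt v).LiftActsOnUnitLogAs (closureAt v).residueChar hpk φ fun t => t + y.coord sb t • y sa := by
    rintro sa sb hsb ⟨φ, -, -, hφfix, hφb⟩
    have ha_le : idx sa ≤ d := (hidx_mem _).2
    have hb_le : idx sb ≤ d := (hidx_mem _).2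
    refine ⟨φ, ?_⟩
    have hLfix : ∀ j, j ≤ d → j ≠ idx sb → liftUnits v φ (uO j) = uO j := fun j hj hjb =>
      liftUnits_eq_of_theta v φ (hθ j hj)
        ((congrArg (absGaloisAbProj (v.adicCompletion F)) (hφfix j hj hjb)).trans (hθ j hj))
    have hLb : liftUnits v φ (uO (idx sb)) = uO (idx sb) * uO (idx sa) :=
      liftUnits_eq_of_theta v φ (hθ _ hb_le)
        ((congrArg (absGaloisAbProj (v.adicCompletion F)) hφb).trans
          (by rw [map_mul, map_mul, map_mul, hθ _ hb_le, hθ _ ha_le]))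
    let T : v.adicCompletion F →ₗ[ℚ_[(closureAt v).residueChar]] v.adicCompletion F :=
      LinearMap.id + (y.coord sb).smulRight (y sa)
    have hT : ∀ t, T t = t + y.coord sb t • y sa := fun t => rfl
    have hgenT : ∀ s' ∈ S, galoisLog v (Additive.ofMul (liftUnits v φ s')) = T (galoisLog v (Additive.ofMul s')) := by
      rintro _ ⟨j, hj, rfl⟩
      rw [hT, hycoord, hy]
      change _ = _ + bR.coord sb (yR j) • _
      rw [hcoord _ j hj hsb]
      by_cases hjb : j = idx sb
      · rw [if_pos hjb, one_smul, hjb, hLb, ofMul_mul, map_add]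
      · rw [if_neg hjb, zero_smul, add_zero, hLfix j hj hjb]
    exact fun xx xx' aa aa' t t' h1 h2 h3 h4 h5 h6 =>
      (liftActsOnUnitLogAs_of_generators v hpk S hS φ T hgenT xx xx' aa aa' t t' h1 h2 h3 h4 h5 h6).trans (hT t)
  -- the answer: the LAST pair `(x_{d−1}, x_d) = (idx (inr 0), idx (inr 1))`
  refine ⟨g, hcg, y, ?_⟩
  have ha : idx (Sum.inr 0) = d - 1 := by simp only [idx, Sum.elim_inr, Fin.val_zero]; omega
  have hb : idx (Sum.inr 1) = d := by simp only [idx, Sum.elim_inr, Fin.val_one]; omega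
  have hlast' : JWTwist σ τ x d (idx (Sum.inr 0)) (idx (Sum.inr 1)) := by rw [ha, hb]; exact hlast
  exact htwist _ _ (by omega) hlast'

/-- **NISHIO'S SHEAR REALISED IN PRINT'S (Ind1) STRIP PART (dyadic place, `√−1 ∈ K_v`).**  Assume `DiekertNishioTwists`.  At every finite
place `v ∣ 2` of `F` with `√−1 ∈ K_v` and `d = [K_v : ℚ_2] ≥ 2` there are `g` with `d = g + 2`, a `ℚ_2`-basis `y` of `K_v^{(1/n_v)}`
(abc-iut-S7's rescaled completion) indexed by `Fin g ⊕ Fin 2`, and `ψ₀ ∈ Real.ind1StripOf v (Real.galoisLog v)` acting as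
`x ↦ x + y^*_{inr 1}(x)·y_{inr 0}` (§1 read in the rescaled norm; continuity from finite dimension over `ℚ_2`; membership via
`realises_galoisLog_of_liftActsOnUnitLogAs`).  The position of `y_{inr 0}` against a given `𝒪_v`-lattice is NOT pinned by print.
[claim: Mochizuki2012, status: disputed] [cite: Nishio2025OuterAutDyadic, Def. 2.5, Thm. 2.6] [cite: Diekert1984, Thm. 3.1 (J. reine angew. Math. 350, pp. 152–172)] -/
theorem exists_realised_shear_of_diekertNishio (hDN : DiekertNishioTwists)
    (p : ℕ) [Fact p.Prime] (hv : ((p : ℕ) : 𝓞 F) ∈ v.asIdeal) (hp2 : p = 2) (hi : ∃ i : v.adicCompletion F, i ^ 2 = -1)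
    (h2 : 2 ≤ localDeg F v) :
    ∃ (g : ℕ) (_ : localDeg F v = g + 2) (y : Module.Basis (Fin g ⊕ Fin 2) ℚ_[p] (RescaledCompletion F p v hv))
      (ψ₀ : v.adicCompletion F ≃+ v.adicCompletion F),
      ψ₀ ∈ ind1StripOf v (galoisLog v) ∧
      ∀ x : RescaledCompletion F p v hv,
        RescaledCompletion.of F p v hv (ψ₀ ((RescaledCompletion.of F p v hv).symm x)) = x + y.coord (Sum.inr 1) x • y (Sum.inr 0) := by
  -- `p` IS the residue characteristic of `K_v`
  obtain rfl : p = (closureAt v).residueChar := eq_residueChar_closureAt_of_natCast_mem v hv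
  have hpk : ValuativeRel.valuation (v.adicCompletion F) (closureAt v).residueChar < 1 :=
    LocalField.valuation_adicCompletion_natCast_lt_one v (closureAt v).residueChar hv
  haveI : CharZero (closureAt v).k := (closureAt v).instChar
  letI iQ : Algebra ℚ_[(closureAt v).residueChar] (closureAt v).k :=
    LocalField.padicAlgebra (closureAt v).k (closureAt v).residueChar hpk
  have hlocal : localDeg F v = Module.finrank ℚ_[(closureAt v).residueChar] (closureAt v).k := by
    exact RescaledCompletion.localDeg_eq_finrank F (closureAt v).residueChar v hv
  have hfin : 2 ≤ Module.finrank ℚ_[(closureAt v).residueChar] (closureAt v).k := by rw [← hlocal]; exact h2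
  -- §1: ONE basis, the last pair realised through THE equivariant lift
  obtain ⟨g, hg, y, φ₀, hφ₀⟩ := dehnTwistLast_closureAt_of_diekertNishio v hDN hpk hp2 hi hfin
  have hcard : localDeg F v = g + 2 := by rw [hlocal, ← hg]
  -- the module topology of `K_v` over `ℚ_2`: linear maps are continuous
  haveI : ContinuousSMul ℚ_[(closureAt v).residueChar] (closureAt v).k :=
    continuousSMul_of_algebraMap ℚ_[(closureAt v).residueChar] _
      (by exact LocalField.continuous_algebraMap_adicCompletionPadicAlgebra v (closureAt v).residueChar hv)
  haveI : FiniteDimensional ℚ_[(closureAt v).residueChar] (closureAt v).k :=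
    Module.finite_of_finrank_pos (by omega)
  have hcoord : ∀ s t : Fin g ⊕ Fin 2, y.coord s (y t) = if t = s then 1 else 0 := by
    intro s t
    rw [Module.Basis.coord_apply, Module.Basis.repr_self, Finsupp.single_apply]
  -- the transvection `x ↦ x + y^*_{inr 1}(x)·y_{inr 0}` as a linear automorphism
  let tv : (closureAt v).k ≃ₗ[ℚ_[(closureAt v).residueChar]] (closureAt v).k :=
    LinearEquiv.ofLinear
      (LinearMap.id + (y.coord (Sum.inr 1)).smulRight (y (Sum.inr 0)))
      (LinearMap.id - (y.coord (Sum.inr 1)).smulRight (y (Sum.inr 0)))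
      (by apply LinearMap.ext; intro x; simp)
      (by apply LinearMap.ext; intro x; simp)
  have htv : ∀ x, tv x = x + y.coord (Sum.inr 1) x • y (Sum.inr 0) := fun x => rfl
  have hψ₀ : tv.toAddEquiv ∈ ind1StripOf v (galoisLog v) :=
    ⟨by exact tv.toLinearMap.continuous_of_finiteDimensional,
      by exact tv.symm.toLinearMap.continuous_of_finiteDimensional, φ₀,
      realises_galoisLog_of_liftActsOnUnitLogAs v hpk φ₀ _ hφ₀ tv.toAddEquiv htv⟩
  -- transport to the rescaled norm (`of` is the identity of `K_v`, `ℚ_2`-linear)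
  let e := RescaledCompletion.of F (closureAt v).residueChar v hv
  let eL : (closureAt v).k ≃ₗ[ℚ_[(closureAt v).residueChar]] RescaledCompletion F (closureAt v).residueChar v hv :=
    { e.toAddEquiv with
      map_smul' := fun c x => by
        change e (c • x) = c • e x
        rw [Algebra.smul_def, Algebra.smul_def, map_mul]
        rfl }
  have heL : ∀ x, eL x = e x := fun x => rfl
  have heLs : ∀ x, eL.symm x = e.symm x := fun x => rfl
  let yR : Module.Basis (Fin g ⊕ Fin 2) ℚ_[(closureAt v).residueChar] (RescaledCompletion F (closureAt v).residueChar v hv) :=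
    y.map eL
  have hyR : ∀ s, yR s = eL (y s) := fun s => Module.Basis.map_apply y eL s
  have hyRc : ∀ s x, yR.coord s x = y.coord s (eL.symm x) := by
    intro s x
    change (y.map eL).repr x s = y.repr (eL.symm x) s
    rw [Module.Basis.map_repr, LinearEquiv.trans_apply]
  refine ⟨g, hcard, yR, tv.toAddEquiv, hψ₀, fun x => ?_⟩
  change e (tv (e.symm x)) = x + yR.coord (Sum.inr 1) x • yR (Sum.inr 0)
  rw [htv, map_add, RingEquiv.apply_symm_apply, hyRc, hyR, ← heL, ← heLs, map_smul]

/-- **PRINT'S (Ind1) STRIP PART IS INFINITE AT EVERY DYADIC PLACE `v` WITH `√−1 ∈ K_v`** (so at every dyadic place of a genuine initial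
Θ-datum, [IUTchI] Def. 3.1 (a)), modulo `DiekertNishioTwists`: the iterates `n • ψ₀` of Nishio's shear satisfy `(n • ψ₀)(y_{inr 1}) =
y_{inr 1} + n·y_{inr 0}`, `y_{inr 0} ≠ 0` (Nishio Thm. 2.6 «`α^n_+ ≠ id`», Cor. 2.7 (i) «the image of the natural homomorphism from the outer
automorphism group of `G` to the automorphism group of `k_+(G)` is infinite»).  Contrast: Dupuy–Hilado's strip slot is `{1}`; the gen-11/12
twins (`ind1StripOf_infinite_of_jannsenWingberg{,First}`) need `p ≠ 2`. [claim: Mochizuki2012, status: disputed]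
[cite: Nishio2025OuterAutDyadic, Thm. 2.6, Cor. 2.7 (i)] [cite: DupuyHilado2025, §4.7] -/
theorem ind1StripOf_infinite_of_diekertNishio (hDN : DiekertNishioTwists)
    (p : ℕ) [Fact p.Prime] (hv : ((p : ℕ) : 𝓞 F) ∈ v.asIdeal) (hp2 : p = 2) (hi : ∃ i : v.adicCompletion F, i ^ 2 = -1)
    (h2 : 2 ≤ localDeg F v) :
    (ind1StripOf v (galoisLog v)).Infinite := by
  obtain ⟨g, -, y, ψ₀, hψ₀, hT₀⟩ := exists_realised_shear_of_diekertNishio v hDN p hv hp2 hi h2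
  set e := RescaledCompletion.of F p v hv with he
  have hcoord : ∀ s t : Fin g ⊕ Fin 2, y.coord s (y t) = if t = s then 1 else 0 := by
    intro s t
    rw [Module.Basis.coord_apply, Module.Basis.repr_self, Finsupp.single_apply]
  have hy0 : y (Sum.inr 0) ≠ 0 := y.ne_zero _
  set χ : AddAut (v.adicCompletion F) := ψ₀ with hχ
  -- the iterates of `χ` act as `x ↦ x + n • (c x • y_{inr 0})`
  have hpow : ∀ (n : ℕ) (x : RescaledCompletion F p v hv),
      e ((n • χ) (e.symm x)) = x + (n : ℚ_[p]) • (y.coord (Sum.inr 1) x • y (Sum.inr 0)) := by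
    intro n
    induction n with
    | zero => intro x; rw [zero_nsmul, Nat.cast_zero, zero_smul, add_zero]; exact e.apply_symm_apply x
    | succ n ih =>
      intro x
      rw [succ_nsmul, AddAut.add_apply, ← e.symm_apply_apply (χ (e.symm x)), hT₀ x, ih, map_add, map_smul, hcoord,
        if_neg (by simp), smul_zero, add_zero, Nat.cast_succ, add_smul, one_smul, add_assoc,
        add_comm (y.coord (Sum.inr 1) x • y (Sum.inr 0))]
  have hinj : Function.Injective fun n : ℕ => n • χ := by
    intro n m hnm
    have h := congrArg (fun ξ : AddAut (v.adicCompletion F) => e (ξ (e.symm (y (Sum.inr 1))))) hnm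
    simp only at h
    rw [hpow, hpow, hcoord, if_pos rfl, one_smul, add_right_inj] at h
    exact_mod_cast smul_left_injective ℚ_[p] hy0 h
  exact Set.infinite_of_injective_forall_mem hinj fun n => nsmul_mem_ind1StripOf v (galoisLog v) hψ₀ n

/-- The same over abc-iut-c312-5's ANALYTIC logarithm. [claim: Mochizuki2012, status: disputed] [cite: Nishio2025OuterAutDyadic, Cor. 2.7 (i)] -/
theorem ind1StripOf_analyticLogv_infinite_of_diekertNishio (hDN : DiekertNishioTwists)
    (p : ℕ) [Fact p.Prime] (hv : ((p : ℕ) : 𝓞 F) ∈ v.asIdeal) (hp2 : p = 2) (hi : ∃ i : v.adicCompletion F, i ^ 2 = -1)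
    (h2 : 2 ≤ localDeg F v) :
    (ind1StripOf v (analyticLogv F v)).Infinite := by
  rw [← galoisLog_eq_analyticLogv]
  exact ind1StripOf_infinite_of_diekertNishio v hDN p hv hp2 hi h2

end Summit.ABC.IUTFork.Thm311.Real

end
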